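import Literature.Probability.LatticeModels.NishimoriPathIdentity
import Literature.Probability.LatticeModels.UnitStepTrails
import HarnessLib

/-!
# Simple lattice paths in `Λ ⊂ ℤ^d` as unit chains on the bond system of `Λ`

The (homological) interface between lattice paths and the path estimator of Garban–Spencer
(arXiv:2109.01617, §2, (2.7)–(2.9): "if `p` is any non-intersecting path going from `0` to `n⃗` …
`e^{i(θ(0) − θ(n⃗))} ∏_{(ij) ∈ p} e^{iω_{i,j}} = ∏_{(ij) ∈ p} Y_{i,j}`"):

* `latticeBonds Λ`: the bond system of the free-boundary nearest-neighbour model on `Λ` — vertices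
  `↥Λ`, bonds the edges of `ℤ^d` with both endpoints in `Λ` (`edgesIn`), each with the fixed
  orientation of `Sym2.out`;
* `chainCoeff Λ L a ∈ {−1, 0, 1}`: the signed number of traversals of the bond `a` by the vertex
  list `L`; for a list of pairwise distinct vertices it is non-zero exactly on the edges of `L`
  (`chainCoeff_ne_zero_iff`), and for a nearest-neighbour chain in `Λ` its holonomy telescopes to
  `θ̄_{head} θ_{last}` (`prod_bondChar_zpow_chainCoeff`), so that `unitChainOf` is a
  `BondSystem.UnitChain` from the first to the last vertex;
* `overlap_unitChainOf_le`: the overlap of two such chains is at most the number of common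
  unordered edges.

## References

* C. Garban, T. Spencer, arXiv:2109.01617, §2, (2.7)–(2.9) and Lemma 2.5. [GarbanSpencer2022]
-/

noncomputable section

open Finset
open scoped BigOperators ComplexConjugate

namespace Literature.Probability.LatticeModels

open Trail

variable {d : ℕ}

/-! ### The bond system of `Λ` -/

/-- A chosen orientation of an unordered pair: `s(e.out.1, e.out.2) = e`. [folklore] -/
theorem Sym2.mk_out {α : Type*} (e : Sym2 α) : s(e.out.1, e.out.2) = e := e.out_eq

/-- **The bond system of the free-boundary nearest-neighbour model on `Λ ⊂ ℤ^d`**: bonds are the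
edges of `ℤ^d` inside `Λ` (`edgesIn (zdGraph d) Λ`), oriented by `Sym2.out`
(Garban–Spencer 2022, §1.2.1: "one may also choose a prescribed direction for each edge").
[cite: GarbanSpencer2022, §1.2.1, Def. 1 and footnote 1] -/
def latticeBonds (Λ : Finset (Site d)) : BondSystem ↥Λ ↥(edgesIn (zdGraph d) Λ) where
  src a := ⟨a.1.out.1, (mem_edgesIn_iff.1 a.2).2 _ (Sym2.out_fst_mem a.1)⟩
  tgt a := ⟨a.1.out.2, (mem_edgesIn_iff.1 a.2).2 _ (Sym2.out_snd_mem a.1)⟩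

variable (Λ : Finset (Site d))

/-- The chosen orientation recovers the bond: `s(src a, tgt a) = a`. [folklore] -/
theorem mk_src_tgt (a : ↥(edgesIn (zdGraph d) Λ)) :
    s(((latticeBonds Λ).src a : Site d), ((latticeBonds Λ).tgt a : Site d)) = (a : Sym2 (Site d)) :=
  Sym2.mk_out a.1

/-- Source and target of a bond are distinct (`ℤ^d` has no loops). [folklore] -/
theorem src_ne_tgt (a : ↥(edgesIn (zdGraph d) Λ)) :
    ((latticeBonds Λ).src a : Site d) ≠ ((latticeBonds Λ).tgt a : Site d) := by
  have h := (mem_edgesIn_iff.1 a.2).1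
  rw [← mk_src_tgt Λ a, SimpleGraph.mem_edgeSet] at h
  exact h.ne

/-- An edge of `ℤ^d` with both endpoints in `Λ` is a bond of `Λ`. [folklore] -/
theorem mk_mem_edgesIn {u w : Site d} (hadj : (zdGraph d).Adj u w) (hu : u ∈ Λ) (hw : w ∈ Λ) :
    s(u, w) ∈ edgesIn (zdGraph d) Λ := by
  rw [mem_edgesIn_iff]
  refine ⟨(SimpleGraph.mem_edgeSet _).2 hadj, fun z hz => ?_⟩
  rcases Sym2.mem_iff.1 hz with rfl | rfl <;> assumption

/-! ### The signed traversal count of a vertex list -/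

/-- The coefficient of the single step `u → w` on the bond `a`: `±1` if `a` is the edge `{u, w}`
(sign according to the orientation of `a`), `0` otherwise. [folklore] -/
def stepCoeff (u w : Site d) (a : ↥(edgesIn (zdGraph d) Λ)) : ℤ :=
  if (a : Sym2 (Site d)) = s(u, w) then (if ((latticeBonds Λ).src a : Site d) = u then 1 else -1) else 0

/-- **The signed traversal count** `chainCoeff Λ L a` of the bond `a` by the vertex list `L`.
[cite: GarbanSpencer2022, §2 Step 1, (2.7)–(2.8)] -/
def chainCoeff : List (Site d) → ↥(edgesIn (zdGraph d) Λ) → ℤ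
  | [] => 0
  | [_] => 0
  | u :: w :: rest => stepCoeff Λ u w + chainCoeff (w :: rest)

/-- `chainCoeff` of a list with at least two vertices. [folklore] -/
@[simp] theorem chainCoeff_cons_cons (u w : Site d) (rest : List (Site d)) :
    chainCoeff Λ (u :: w :: rest) = stepCoeff Λ u w + chainCoeff Λ (w :: rest) := rfl

/-- `chainCoeff [v] = 0`. [folklore] -/
@[simp] theorem chainCoeff_singleton (v : Site d) : chainCoeff Λ [v] = 0 := rfl

/-- `chainCoeff [] = 0`. [folklore] -/
@[simp] theorem chainCoeff_nil : chainCoeff Λ ([] : List (Site d)) = 0 := rfl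

/-- `|stepCoeff| ≤ 1`, and it vanishes off the edge `{u, w}`. [folklore] -/
theorem stepCoeff_eq_zero_of_ne {u w : Site d} {a : ↥(edgesIn (zdGraph d) Λ)} (h : (a : Sym2 (Site d)) ≠ s(u, w)) :
    stepCoeff Λ u w a = 0 := by simp [stepCoeff, h]

/-- `|stepCoeff| ≤ 1`. [folklore] -/
theorem natAbs_stepCoeff_le (u w : Site d) (a : ↥(edgesIn (zdGraph d) Λ)) : (stepCoeff Λ u w a).natAbs ≤ 1 := by
  unfold stepCoeff; split_ifs <;> simp

/-- **Support of the traversal count**: for pairwise distinct vertices, `chainCoeff L a ≠ 0` iff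
`a` is an edge of `L`; and then `|chainCoeff L a| = 1`. [folklore] -/
theorem chainCoeff_spec {L : List (Site d)} (hnd : L.Nodup) (a : ↥(edgesIn (zdGraph d) Λ)) :
    (chainCoeff Λ L a ≠ 0 ↔ (a : Sym2 (Site d)) ∈ edges L) ∧ (chainCoeff Λ L a).natAbs ≤ 1 := by
  induction L with
  | nil => simp
  | cons u M ih =>
    cases M with
    | nil => simp
    | cons w rest =>
      have hnd' : (w :: rest).Nodup := (List.nodup_cons.1 hnd).2
      have hu : u ∉ w :: rest := (List.nodup_cons.1 hnd).1
      obtain ⟨ih1, ih2⟩ := ih hnd'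
      rw [chainCoeff_cons_cons, edges_cons_cons, List.mem_cons, Pi.add_apply]
      by_cases h : (a : Sym2 (Site d)) = s(u, w)
      · -- the step `u → w` is on `a`, the rest of the path avoids it
        have hrest : chainCoeff Λ (w :: rest) a = 0 := by
          by_contra hc
          have hmem := ih1.1 hc
          rw [h] at hmem
          exact hu (mem_of_mem_edges hmem (Sym2.mem_mk_left u w))
        rw [hrest, add_zero]
        refine ⟨⟨fun _ => Or.inl h, fun _ => ?_⟩, natAbs_stepCoeff_le Λ u w a⟩
        unfold stepCoeff; rw [if_pos h]; split_ifs <;> simp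
      · rw [stepCoeff_eq_zero_of_ne Λ h, zero_add]
        exact ⟨⟨fun hc => Or.inr (ih1.1 hc), fun hm => ih1.2 (hm.resolve_left h)⟩, ih2⟩

/-! ### The holonomy telescopes -/

/-- The holonomy of a single step is the relative angle of its endpoints, whatever the orientation
of the bond: `∏_a χ_a(θ)^{stepCoeff u w a} = θ̄_u θ_w` for an edge `{u, w}` inside `Λ`. [folklore] -/
theorem prod_bondChar_zpow_stepCoeff {u w : Site d} (hadj : (zdGraph d).Adj u w) (hu : u ∈ Λ) (hw : w ∈ Λ)
    (θ : ↥Λ → Circle) :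
    ∏ a, (((latticeBonds Λ).bondChar a θ : Circle) : ℂ) ^ stepCoeff Λ u w a =
      conj ((θ ⟨u, hu⟩ : Circle) : ℂ) * θ ⟨w, hw⟩ := by
  set a₀ : ↥(edgesIn (zdGraph d) Λ) := ⟨s(u, w), mk_mem_edgesIn Λ hadj hu hw⟩ with ha₀
  rw [Finset.prod_eq_single a₀]
  · have hsrc := mk_src_tgt Λ a₀
    simp only [ha₀, Subtype.coe_mk] at hsrc
    rw [Sym2.eq_iff] at hsrc
    have huw : u ≠ w := hadj.ne
    unfold stepCoeff
    rw [if_pos (by simp [ha₀])]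
    rw [BondSystem.bondChar_apply, BondSystem.bondVar_one, Circle.coe_mul, Circle.coe_inv_eq_conj]
    rcases hsrc with ⟨h1, h2⟩ | ⟨h1, h2⟩
    · rw [if_pos h1, zpow_one]
      have e1 : (latticeBonds Λ).src a₀ = ⟨u, hu⟩ := Subtype.ext h1
      have e2 : (latticeBonds Λ).tgt a₀ = ⟨w, hw⟩ := Subtype.ext h2
      rw [e1, e2]
    · have hne : ((latticeBonds Λ).src a₀ : Site d) ≠ u := by rw [h1]; exact huw.symm
      rw [if_neg hne, zpow_neg, zpow_one]
      have e1 : (latticeBonds Λ).src a₀ = ⟨w, hw⟩ := Subtype.ext h1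
      have e2 : (latticeBonds Λ).tgt a₀ = ⟨u, hu⟩ := Subtype.ext h2
      rw [e1, e2, mul_inv, Complex.inv_def, Complex.inv_def]
      simp only [Complex.conj_conj, Circle.normSq_coe, inv_one, Complex.ofReal_one, mul_one]
      rw [Complex.normSq_conj, Circle.normSq_coe]; simp [mul_comm]
  · intro a _ ha
    have : (a : Sym2 (Site d)) ≠ s(u, w) := fun h => ha (Subtype.ext (by rw [h, ha₀]))
    rw [stepCoeff_eq_zero_of_ne Λ this, zpow_zero]
  · intro h; exact absurd (Finset.mem_univ _) h

/-- **The holonomy of a nearest-neighbour chain in `Λ` telescopes**: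
`∏_a χ_a(θ)^{chainCoeff L a} = θ̄_{head L} θ_{last L}`. [cite: GarbanSpencer2022, §2 Step 1, display before (2.8)] -/
theorem prod_bondChar_zpow_chainCoeff {L : List (Site d)} (hchain : List.IsChain (zdGraph d).Adj L)
    (hΛ : ∀ z ∈ L, z ∈ Λ) (hne : L ≠ []) (θ : ↥Λ → Circle) :
    ∏ a, (((latticeBonds Λ).bondChar a θ : Circle) : ℂ) ^ chainCoeff Λ L a =
      conj ((θ ⟨L.head hne, hΛ _ (List.head_mem hne)⟩ : Circle) : ℂ) *
        θ ⟨L.getLast hne, hΛ _ (List.getLast_mem hne)⟩ := by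
  induction L with
  | nil => exact absurd rfl hne
  | cons u M ih =>
    cases M with
    | nil =>
      simp only [chainCoeff_singleton, Pi.zero_apply, zpow_zero, Finset.prod_const_one, List.head_cons,
        List.getLast_singleton]
      rw [← Complex.normSq_eq_conj_mul_self, Circle.normSq_coe, Complex.ofReal_one]
    | cons w rest =>
      have hadj : (zdGraph d).Adj u w := (List.isChain_cons_cons.1 hchain).1
      have hchain' : List.IsChain (zdGraph d).Adj (w :: rest) := (List.isChain_cons_cons.1 hchain).2
      have hΛ' : ∀ z ∈ w :: rest, z ∈ Λ := fun z hz => hΛ z (List.mem_cons_of_mem _ hz)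
      have ih' := ih hchain' hΛ' (List.cons_ne_nil _ _)
      have hχ : ∀ a : ↥(edgesIn (zdGraph d) Λ), (((latticeBonds Λ).bondChar a θ : Circle) : ℂ) ≠ 0 :=
        fun a => Circle.coe_ne_zero _
      simp only [chainCoeff_cons_cons, Pi.add_apply]
      rw [Finset.prod_congr rfl fun a _ => zpow_add₀ (hχ a) _ _, Finset.prod_mul_distrib,
        prod_bondChar_zpow_stepCoeff Λ hadj (hΛ u (List.mem_cons_self)) (hΛ' w (List.mem_cons_self)), ih']
      simp only [List.head_cons, List.getLast_cons_cons]
      -- (ū w)(w̄ y) = ū y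
      have hw1 : ((θ ⟨w, hΛ' w (List.mem_cons_self)⟩ : Circle) : ℂ) * conj ((θ ⟨w, hΛ' w (List.mem_cons_self)⟩ : Circle) : ℂ) = 1 := by
        rw [Complex.mul_conj, Circle.normSq_coe, Complex.ofReal_one]
      calc conj ((θ ⟨u, hΛ u List.mem_cons_self⟩ : Circle) : ℂ) * (θ ⟨w, _⟩ : ℂ) *
            (conj ((θ ⟨w, _⟩ : Circle) : ℂ) * (θ ⟨(w :: rest).getLast (List.cons_ne_nil _ _), _⟩ : ℂ))
          = conj ((θ ⟨u, hΛ u List.mem_cons_self⟩ : Circle) : ℂ) *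
              (((θ ⟨w, hΛ' w List.mem_cons_self⟩ : Circle) : ℂ) * conj ((θ ⟨w, hΛ' w List.mem_cons_self⟩ : Circle) : ℂ)) *
              (θ ⟨(w :: rest).getLast (List.cons_ne_nil _ _), hΛ' _ (List.getLast_mem _)⟩ : ℂ) := by ring
        _ = _ := by rw [hw1, mul_one]

/-! ### The unit chain of a simple lattice path and its overlap -/

/-- **The unit chain of a simple nearest-neighbour path in `Λ`** from `x` to `y`.
[cite: GarbanSpencer2022, §2 Step 1, (2.7)–(2.9)] -/
def unitChainOf {L : List (Site d)} (hchain : List.IsChain (zdGraph d).Adj L) (hnd : L.Nodup)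
    (hΛ : ∀ z ∈ L, z ∈ Λ) (hne : L ≠ []) {x y : ↥Λ} (hx : L.head hne = x) (hy : L.getLast hne = y) :
    (latticeBonds Λ).UnitChain x y where
  coeff := chainCoeff Λ L
  natAbs_le a := (chainCoeff_spec Λ hnd a).2
  boundary θ := by
    rw [prod_bondChar_zpow_chainCoeff Λ hchain hΛ hne θ, diffChar_apply, Circle.coe_mul, Circle.coe_inv_eq_conj]
    congr

/-- **Overlap is bounded by common edges**: the overlap of the unit chains of two simple paths is
at most the number of unordered lattice edges they share. [cite: GarbanSpencer2022, Lemma 2.5 (`|p₁ ∩ p₂|`)] -/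
theorem overlap_unitChainOf_le {L L' : List (Site d)}
    (hchain : List.IsChain (zdGraph d).Adj L) (hnd : L.Nodup) (hΛ : ∀ z ∈ L, z ∈ Λ) (hne : L ≠ [])
    (hchain' : List.IsChain (zdGraph d).Adj L') (hnd' : L'.Nodup) (hΛ' : ∀ z ∈ L', z ∈ Λ) (hne' : L' ≠ [])
    {x y : ↥Λ} (hx : L.head hne = x) (hy : L.getLast hne = y) (hx' : L'.head hne' = x) (hy' : L'.getLast hne' = y) :
    (unitChainOf Λ hchain hnd hΛ hne hx hy).overlap (unitChainOf Λ hchain' hnd' hΛ' hne' hx' hy') ≤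
      #((edges L).toFinset ∩ (edges L').toFinset) := by
  classical
  unfold BondSystem.UnitChain.overlap
  refine Finset.card_le_card_of_injOn (fun a => (a : Sym2 (Site d))) (fun a ha => ?_)
    (fun a _ b _ h => Subtype.ext h)
  simp only [Finset.coe_filter, Finset.mem_univ, true_and, Set.mem_setOf_eq] at ha
  simp only [Finset.coe_inter, Set.mem_inter_iff, Finset.mem_coe, List.mem_toFinset]
  exact ⟨(chainCoeff_spec Λ hnd a).1.1 ha.1, (chainCoeff_spec Λ hnd' a).1.1 ha.2⟩

end Literature.Probability.LatticeModels
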